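import Summits.ValiantsHypothesis.ValiantsHypothesis.Theses.GeneratorObstructions
import Literature.Computability.AlgebraicComplexity.CharpolyCoeffPowTrace
import Literature.Computability.AlgebraicComplexity.VPDeterminantalQPProofs
import Literature.Computability.AlgebraicComplexity.StandardFamilies

/-!
# ValiantsHypothesis / GeneratorObstructions — `PerPowTraceQP`

Route `GeneratorObstructions`, item `stmt-ValiantsHypothesis-11661` (support, rank 9):
`VP ⇒` quasi-polynomial trace-power representations of the permanent, in window form — if
`(per_n)_n` is a `VP` family over `ℂ` then for some constant `c` every `per_m` (`m ≥ 1`) is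
`tr(A^m)` for a square matrix `A` of homogeneous linear forms of size exactly `m + e` with
`m + e ≤ 2^((log₂ m + c)^c)`.

Bookkeeping on four PROVED tree results:

* `isQPBounded_determinantalComplexity_of_isVPFamily_holds` (Bürgisser–Clausen–Shokrollahi 1997,
  Cor. (21.40); `VPDeterminantalQPProofs.lean`): `VP ⇒ dc(per_m) ≤ 2^((log₂ m + c)^c)`;
* `hasDetRepr_iff_determinantalComplexity_le_holds` (Mignon–Ressayre 2004, §1): an affine
  determinantal expression of every size `≥ dc`;
* `perPoly_isHomogeneous` (`per_m` is a form of degree `m`);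
* `IkenmeyerLandsberg2017_powTrace_of_detRepr_holds` (Ikenmeyer–Landsberg 2017, Thm. 4.1 with
  Rem. 4.5, discharged in `CharpolyCoeffPowTrace.lean` via the Faddeev–LeVerrier program): an
  affine determinantal expression of size `s` of a form of degree `d ≥ 1` gives `tr(A^d)` with
  `A` of size `N`, `N + 1 ≤ (d+1)((s³ − s)/3 + 2)`;

plus zero-padding of a trace-power representation (`exists_powTrace_pad`, block `A ⊕ 0`) and the
exponent arithmetic `(m+1)((s³−s)/3+2) ≤ 2^((log₂ m + c + 3)^(c+3))` for `s = 2^((log₂ m + c)^c)`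
(`powTrace_size_le`). The representation is padded to size EXACTLY `2^((log₂ m + c')^c')`,
`c' = c + 3`, so the window inequality is an equality.

Nothing else is here (no ABPs, no Nisan homogenisation: the Ikenmeyer–Landsberg chain replaces
the printed Nisan / Mahajan–Vinay route of the item's proof plan).
-/

namespace Summit.ValiantsHypothesis.ValiantsHypothesis.Theorems

open MvPolynomial Literature.Computability.AlgebraicComplexity

-- `Summit.ValiantsHypothesis.ValiantsHypothesis.…` is the tree's mandated single-conjunct layout (Sub = Summit).
set_option linter.dupNamespace false

/-- **Zero-padding of trace-power representations.** If `tr(A^d) = P` for an `N × N` matrix `A`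
of homogeneous linear forms and `1 ≤ d`, `N ≤ N'`, then `tr(A'^d) = P` for the `N' × N'` matrix
`A' = A ⊕ 0` (reindexed along `Fin N ⊕ Fin (N' − N) ≃ Fin N'`), again of homogeneous linear forms:
`(A ⊕ 0)^d = A^d ⊕ 0^d` and `0^d = 0`. [folklore] -/
theorem exists_powTrace_pad {σ : Type*} {P : MvPolynomial σ ℂ} {d N N' : ℕ} (hd : 1 ≤ d)
    (hN : N ≤ N') {A : Matrix (Fin N) (Fin N) (MvPolynomial σ ℂ)}
    (hA : ∀ i j, (A i j).IsHomogeneous 1) (htr : (A ^ d).trace = P) :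
    ∃ A' : Matrix (Fin N') (Fin N') (MvPolynomial σ ℂ),
      (∀ i j, (A' i j).IsHomogeneous 1) ∧ (A' ^ d).trace = P := by
  classical
  set e : Fin N ⊕ Fin (N' - N) ≃ Fin N' :=
    finSumFinEquiv.trans (finCongr (Nat.add_sub_cancel' hN)) with he
  refine ⟨Matrix.reindex e e
    (Matrix.fromBlocks A 0 0 (0 : Matrix (Fin (N' - N)) (Fin (N' - N)) (MvPolynomial σ ℂ))),
    fun i j => ?_, ?_⟩
  · rw [Matrix.reindex_apply, Matrix.submatrix_apply]
    rcases e.symm i with i' | i' <;> rcases e.symm j with j' | j'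
    · rw [Matrix.fromBlocks_apply₁₁]; exact hA _ _
    · rw [Matrix.fromBlocks_apply₁₂]; exact isHomogeneous_zero _ _ _
    · rw [Matrix.fromBlocks_apply₂₁]; exact isHomogeneous_zero _ _ _
    · rw [Matrix.fromBlocks_apply₂₂]; exact isHomogeneous_zero _ _ _
  · rw [← Matrix.coe_reindexAlgEquiv ℂ (MvPolynomial σ ℂ) e, ← map_pow, Matrix.coe_reindexAlgEquiv,
      trace_reindex, Matrix.fromBlocks_diagonal_pow, zero_pow (by omega), ← htr]
    simp only [Matrix.trace, Matrix.diag_apply, Fintype.sum_sum_type, Matrix.fromBlocks_apply₁₁,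
      Matrix.fromBlocks_apply₂₂, Matrix.zero_apply, Finset.sum_const_zero, add_zero]

/-- **The exponent arithmetic.** With `ℓ = log₂ m` and `s = 2^((ℓ + c)^c)`: if
`N + 1 ≤ (m + 1)((s³ − s)/3 + 2)` then both `N` and `m` are at most `2^((ℓ + (c+3))^(c+3))`
(`m + 1 ≤ 2^(ℓ+1)`, `(s³ − s)/3 + 2 ≤ 2^(3t+2)` for `t = (ℓ+c)^c ≥ 1`, and
`ℓ + 3t + 3 ≤ t(27ℓ + 27) ≤ (ℓ+c+3)^c (ℓ+c+3)^3`). [folklore] -/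
theorem powTrace_size_le {m c N : ℕ}
    (hN : N + 1 ≤ (m + 1) *
      (((2 ^ ((Nat.log 2 m + c) ^ c)) ^ 3 - 2 ^ ((Nat.log 2 m + c) ^ c)) / 3 + 2)) :
    N ≤ 2 ^ ((Nat.log 2 m + (c + 3)) ^ (c + 3)) ∧
      m ≤ 2 ^ ((Nat.log 2 m + (c + 3)) ^ (c + 3)) := by
  set ℓ := Nat.log 2 m with hℓ
  set t := (ℓ + c) ^ c with ht_def
  have ht : 1 ≤ t := by
    rcases Nat.eq_zero_or_pos c with h0 | hc
    · rw [ht_def, h0, pow_zero]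
    · exact Nat.one_le_pow _ _ (by omega)
  have hm : m < 2 ^ (ℓ + 1) := Nat.lt_pow_succ_log_self Nat.one_lt_two m
  -- the key exponent inequality
  have key : ℓ + 3 * t + 3 ≤ (ℓ + (c + 3)) ^ (c + 3) := by
    have h1 : t ≤ (ℓ + (c + 3)) ^ c := Nat.pow_le_pow_left (by omega) c
    have h2 : 27 * ℓ + 27 ≤ (ℓ + (c + 3)) ^ 3 := by
      have h3 : (ℓ + 3) ^ 3 = ℓ ^ 3 + 9 * ℓ ^ 2 + (27 * ℓ + 27) := by ring
      calc 27 * ℓ + 27 ≤ (ℓ + 3) ^ 3 := by rw [h3]; exact Nat.le_add_left _ _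
        _ ≤ (ℓ + (c + 3)) ^ 3 := Nat.pow_le_pow_left (by omega) 3
    have h4 : ℓ ≤ t * ℓ := by simpa using Nat.mul_le_mul_right ℓ ht
    calc ℓ + 3 * t + 3 ≤ t * (27 * ℓ + 27) := by
          rw [Nat.mul_add, ← Nat.mul_assoc, Nat.mul_comm t 27, Nat.mul_assoc]
          omega
      _ ≤ (ℓ + (c + 3)) ^ c * (ℓ + (c + 3)) ^ 3 := Nat.mul_le_mul h1 h2
      _ = (ℓ + (c + 3)) ^ (c + 3) := by rw [← pow_add]
  refine ⟨?_, ?_⟩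
  · -- `(s³ - s)/3 + 2 ≤ 2^(3t + 2)`
    have hφ : ((2 ^ t) ^ 3 - 2 ^ t) / 3 + 2 ≤ 2 ^ (3 * t + 2) := by
      have h1 : ((2 ^ t) ^ 3 - 2 ^ t) / 3 ≤ 2 ^ (3 * t) := by
        calc ((2 ^ t) ^ 3 - 2 ^ t) / 3 ≤ (2 ^ t) ^ 3 - 2 ^ t := Nat.div_le_self _ _
          _ ≤ (2 ^ t) ^ 3 := Nat.sub_le _ _
          _ = 2 ^ (3 * t) := by rw [← pow_mul, Nat.mul_comm]
      have h2 : 2 ≤ 2 ^ (3 * t) := by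
        calc 2 = 2 ^ 1 := rfl
          _ ≤ 2 ^ (3 * t) := Nat.pow_le_pow_right (by norm_num) (by omega)
      calc ((2 ^ t) ^ 3 - 2 ^ t) / 3 + 2 ≤ 2 ^ (3 * t) + 2 ^ (3 * t) := Nat.add_le_add h1 h2
        _ = 2 ^ (3 * t + 1) := by rw [pow_succ]; ring
        _ ≤ 2 ^ (3 * t + 2) := Nat.pow_le_pow_right (by norm_num) (by omega)
    calc N ≤ (m + 1) * (((2 ^ t) ^ 3 - 2 ^ t) / 3 + 2) := by omega
      _ ≤ 2 ^ (ℓ + 1) * 2 ^ (3 * t + 2) := Nat.mul_le_mul hm hφ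
      _ = 2 ^ (ℓ + 3 * t + 3) := by rw [← pow_add]; ring_nf
      _ ≤ 2 ^ ((ℓ + (c + 3)) ^ (c + 3)) := Nat.pow_le_pow_right (by norm_num) key
  · calc m ≤ 2 ^ (ℓ + 1) := hm.le
      _ ≤ 2 ^ ((ℓ + (c + 3)) ^ (c + 3)) := Nat.pow_le_pow_right (by norm_num) (by omega)

/-- Settles `stmt-ValiantsHypothesis-11661` (`PerPowTraceQP`, route `GeneratorObstructions`):
if `(per_n)_n` is a `VP` family over `ℂ` then there is `c` such that every `per_m`, `m ≥ 1`, is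
`tr(A^m)` for an `(m+e) × (m+e)` matrix `A` of homogeneous linear forms in the `m²` variables with
`m + e ≤ 2^((log₂ m + c)^c)`. Proof: `VP ⇒ dc(per_m) ≤ s = 2^((log₂ m + c)^c)`
(Bürgisser–Clausen–Shokrollahi 1997, Cor. (21.40), in tree), so `per_m = det` of an affine `s × s`
matrix (Mignon–Ressayre 2004, §1); `per_m` is a form of degree `m ≥ 1`, so Ikenmeyer–Landsberg
2017, Thm. 4.1/Rem. 4.5 (in tree, via Faddeev–LeVerrier) gives `per_m = tr(A^m)` with `A` of size
`N < (m+1)((s³−s)/3+2) ≤ 2^((log₂ m + c + 3)^(c+3))`; pad `A` with zeros to that exact size.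
[cite: IkenmeyerLandsberg2017, Thm. 4.1 and Rem. 4.5] -/
theorem perPowTraceQP_proof :
    Summit.ValiantsHypothesis.ValiantsHypothesis.Theses.GeneratorObstructions.PerPowTraceQP := by
  unfold Summit.ValiantsHypothesis.ValiantsHypothesis.Theses.GeneratorObstructions.PerPowTraceQP
  intro hVP
  obtain ⟨c, hc⟩ := isQPBounded_determinantalComplexity_of_isVPFamily_holds
    (fun n => perPoly (Fin n) ℂ) hVP
  refine ⟨c + 3, fun m hm => ?_⟩
  -- an affine determinantal expression of size `s = 2^((log₂ m + c)^c)`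
  have hdet : HasDetRepr (perPoly (Fin m) ℂ) (2 ^ ((Nat.log 2 m + c) ^ c)) :=
    (hasDetRepr_iff_determinantalComplexity_le_holds _ _).2 (hc m)
  have hhom : (perPoly (Fin m) ℂ).IsHomogeneous m := by
    simpa using (perPoly_isHomogeneous (n := Fin m) (k := ℂ))
  -- Ikenmeyer–Landsberg: `per_m = tr(A^m)`, `A` of size `N`
  obtain ⟨N, A, hN, hA, htr⟩ :=
    IkenmeyerLandsberg2017_powTrace_of_detRepr_holds (perPoly (Fin m) ℂ) m _ hm hhom hdet
  obtain ⟨hNT, hmT⟩ := powTrace_size_le hN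
  -- pad to size exactly `T = 2^((log₂ m + c + 3)^(c+3))`, `e = T - m`
  refine ⟨2 ^ ((Nat.log 2 m + (c + 3)) ^ (c + 3)) - m, by omega, ?_⟩
  exact exists_powTrace_pad hm (by omega) hA htr

end Summit.ValiantsHypothesis.ValiantsHypothesis.Theorems
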